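import Summits.BirchSwinnertonDyer.Rank1Residual.Additive.GordCharLeadingTerm
import HarnessLib

/-!
# The (G)-cell at analytic rank `0` with Delbourgo 2002 in the kernel, II: consequences of
# `ord_p #Ш_an + ord_p c = ord_p #Ш + ord_p ℓ` and the class forms on X4♯(G-ord) / X3♯(G-ord)
# (cell `b2b-bsdres`, sub-cell additive-p2, gen 18; sequel of `GordCharLeadingTerm.lean`)

HONEST FRAMING (cell `b2b-bsdres`, run/shared/lean/b2b/bsd-rank1-residual/, verbatim in every
file): the goal of the cell is to DELETE the COMBINATION-SHAPED residual classes of the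
Birch–Swinnerton-Dyer formula for ALL analytic-rank `≤ 1` elliptic curves over `ℚ` — "full BSD
formula for every rank `≤ 1` curve in class `C`" assembled STRICTLY from published theorems — so
that the rank-`≤ 1` remainder becomes exactly the CONSTRUCTION-SHAPED classes, which are TYPED
(missing-input `Prop`s), NOT attempted. This is not "finishing BSD". Sub-cell `additive-p2`, gen 18:
research route; no claim beyond the stated classes; X3♯(G-ord)/X4♯(G-ord) stay CONSTRUCTION-SHAPED;
labels / census / located gap UNCHANGED; nothing is booked. Theorems only (no `def`, no new fact).

Contents (see the module docstring of `GordCharLeadingTerm.lean` for the whole story):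
* §2 on the (G)-cell (`Addv ∧ TypeGOrd`, `E` non-CM, `p ≥ 5`, `r_an = 0`): the LOWER divisibility
  `CycLowerLeadingTermAt` ⟹ `Typed.MissingLowerBoundAt` off the anomalous rows and
  `ord_p #Ш_an ≤ ord_p #Ш + 2` on every row; the EQUALITY `CycCharLeadingTermAt` ⟹
  `Typed.MissingUpperBoundAt` and `ord_p #Ш ≤ ord_p #Ш_an ≤ ord_p #Ш + 2` on every row, `BSD(E,p)` off
  the anomalous rows — no image / Tamagawa / Manin / `#Ш_an` hypothesis, every defect;
* §3 class forms on X4♯(G-ord) and X3♯(G-ord), and `BSD(E,p) ⇐ CycLowerLeadingTermAt` ALONE where the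
  upper half is discharged (X4♯(G-ord) ∩ `I₀*` ∩ {`ρ̄` onto} via Kato's component reading A124;
  X3♯(G-ord) ∩ `I₀*` via Wuthrich's A125) — the residual map's `X_D1` as a kernel implication.

References: D. Delbourgo, J. Number Theory 95 (2002) Theorem (A), (B) [Delbourgo2002]; Compositio
Math. 113 (1998) Prop. 4, Main Conjecture p. 151 [Delbourgo1998]; K. Kato, Astérisque 295 (2004)
Thm. 17.4 [Kato2004Asterisque]; C. Wuthrich, Doc. Math. 19 (2014) Thm. 16 [Wuthrich2014];
R. L. Miller, LMS J. Comput. Math. 14 (2011) Def. 1.1 [Miller2011LMS].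
-/

noncomputable section

open scoped Classical NumberField

open WeierstrassCurve NumberField Literature.NumberTheory.EllipticCurves
  Literature.NumberTheory.EllipticCurves.ModularForms
  Literature.NumberTheory.EllipticCurves.Rank1Residual
  Literature.NumberTheory.EllipticCurves.Rank1Residual.Typed
  IsDedekindDomain

namespace Summit.BirchSwinnertonDyer.Rank1Residual.Additive

variable (W : WeierstrassCurve ℚ) (p : ℕ) [hp : Fact p.Prime] [W.IsElliptic] [W.IsGloballyMinimal]

/-! ### §2 Consequences on the (G)-cell (rank `0`, `p ≥ 5`, `E` non-CM) -/

omit [W.IsElliptic] [W.IsGloballyMinimal] in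
/-- `ℓ ∣ p²` forces `ord_p ℓ ≤ 2`. [folklore] -/
theorem padicValNat_le_two_of_dvd_sq {ℓ : ℕ} (h : ℓ ∣ p ^ 2) : padicValNat p ℓ ≤ 2 := by
  obtain ⟨k, hk, rfl⟩ := (Nat.dvd_prime_pow hp.out).mp h
  rw [padicValNat.prime_pow]
  exact hk

/-- **LOWER HALF from the LOWER divisibility, off the anomalous rows.** In the setting of the core
theorem, if the good reduction of `E` over the (G)-field is non-anomalous
(`Delbourgo2002.ReductionNonAnomalous W p`), then `CycLowerLeadingTermAt W p` gives
`Typed.MissingLowerBoundAt W p` (`ord_p #Ш_an(E) ≤ ord_p #Ш(E)`): the cofactor `c ∈ ℤ_p` only helps.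
On these rows the cell's rank-`0` residue "the lower half" IS IMPLIED BY the lower divisibility of
Delbourgo's Main Conjecture (G) at `T = 0` — a kernel implication, no longer an identification by
prose (RESIDUAL-MAP §I N10, `X_D1`). [cite: Delbourgo2002, Theorem (B) (p. 40)] [cite: Delbourgo1998, Main Conjecture (p. 151)] -/
theorem missingLowerBoundAt_rankZero_of_typeGOrd_of_cycLower_of_nonAnomalous (hDel : Delbourgo2002.mainTheorem)
    (hGZK : rank_eq_analyticRank_of_analyticRank_le_one) (hmod : hasEntireLFunction_rat)
    (hp5 : 5 ≤ p) (hcm : ¬ W.HasCM) (hadd : Addv W p) (hG : TypeGOrd W p)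
    (hr : W.analyticRank = 0) (hLow : CycLowerLeadingTermAt W p)
    (hna : Delbourgo2002.ReductionNonAnomalous W p) : MissingLowerBoundAt W p := by
  obtain ⟨q, hq, -, c, ℓ, -, -, hℓ1, hval⟩ :=
    exists_padicVal_shaAn_of_cycLowerLeadingTerm W p hDel hGZK hmod hp5 hcm hadd hG hr hLow
  refine ⟨q, hq, ?_⟩
  rw [hℓ1 hna, padicValNat_one_right, Nat.cast_zero, add_zero] at hval
  have hc : 0 ≤ ((c : ℤ_[p]) : ℚ_[p]).valuation := PadicInt.valuation_coe_nonneg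
  linarith

/-- **Lower divisibility, any row: `ord_p #Ш_an(E) ≤ ord_p #Ш(E) + 2`** (the slack is the unread
local factor `ℓ_p(E)` of the anomalous rows). [cite: Delbourgo2002, Theorem (B) (p. 40)] -/
theorem padicVal_shaAn_le_add_two_rankZero_of_cycLower (hDel : Delbourgo2002.mainTheorem)
    (hGZK : rank_eq_analyticRank_of_analyticRank_le_one) (hmod : hasEntireLFunction_rat)
    (hp5 : 5 ≤ p) (hcm : ¬ W.HasCM) (hadd : Addv W p) (hG : TypeGOrd W p)
    (hr : W.analyticRank = 0) (hLow : CycLowerLeadingTermAt W p) :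
    ∃ q : ℚ, shaAn W = (q : ℂ) ∧ padicValRat p q ≤ (padicValNat p W.shaOrder : ℤ) + 2 := by
  obtain ⟨q, hq, -, c, ℓ, -, hℓp, -, hval⟩ :=
    exists_padicVal_shaAn_of_cycLowerLeadingTerm W p hDel hGZK hmod hp5 hcm hadd hG hr hLow
  refine ⟨q, hq, ?_⟩
  have hc : 0 ≤ ((c : ℤ_[p]) : ℚ_[p]).valuation := PadicInt.valuation_coe_nonneg
  have hℓ : (padicValNat p ℓ : ℤ) ≤ 2 := by exact_mod_cast padicValNat_le_two_of_dvd_sq p hℓp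
  linarith

/-- **MC EQUALITY ⟹ the UPPER half `ord_p #Ш(E) ≤ ord_p #Ш_an(E)` on EVERY row of the (G)-cell** —
now from Delbourgo 2002 (compare gen 13's route through Delbourgo 1998 Prop. 4,
`missingUpperBoundAt_of_cycLeadingTerm_of_five_le`, which this does not use).
[cite: Delbourgo2002, Theorem (B) (p. 40)] -/
theorem missingUpperBoundAt_rankZero_of_cycChar (hDel : Delbourgo2002.mainTheorem)
    (hGZK : rank_eq_analyticRank_of_analyticRank_le_one) (hmod : hasEntireLFunction_rat)
    (hp5 : 5 ≤ p) (hcm : ¬ W.HasCM) (hadd : Addv W p) (hG : TypeGOrd W p)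
    (hr : W.analyticRank = 0) (hMC : CycCharLeadingTermAt W p) : MissingUpperBoundAt W p := by
  obtain ⟨q, hq, -, ℓ, -, -, hval⟩ :=
    exists_padicVal_shaAn_of_cycCharLeadingTerm W p hDel hGZK hmod hp5 hcm hadd hG hr hMC
  refine ⟨q, hq, ?_⟩
  have hℓ : (0 : ℤ) ≤ padicValNat p ℓ := by exact_mod_cast Nat.zero_le _
  linarith

/-- **MC EQUALITY ⟹ `ord_p #Ш(E) ≤ ord_p #Ш_an(E) ≤ ord_p #Ш(E) + 2` on EVERY row of the (G)-cell**
(rank `0`, `p ≥ 5`, non-CM; NO image, Tamagawa, Manin or `#Ш_an` hypothesis, every defect). The slack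
is the unread `ℓ_p(E)` of the anomalous rows. [cite: Delbourgo2002, Theorem (B) (p. 40)] -/
theorem padicVal_shaAn_bounds_rankZero_of_cycChar (hDel : Delbourgo2002.mainTheorem)
    (hGZK : rank_eq_analyticRank_of_analyticRank_le_one) (hmod : hasEntireLFunction_rat)
    (hp5 : 5 ≤ p) (hcm : ¬ W.HasCM) (hadd : Addv W p) (hG : TypeGOrd W p)
    (hr : W.analyticRank = 0) (hMC : CycCharLeadingTermAt W p) :
    ∃ q : ℚ, shaAn W = (q : ℂ) ∧ (padicValNat p W.shaOrder : ℤ) ≤ padicValRat p q ∧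
      padicValRat p q ≤ (padicValNat p W.shaOrder : ℤ) + 2 := by
  obtain ⟨q, hq, -, ℓ, hℓp, -, hval⟩ :=
    exists_padicVal_shaAn_of_cycCharLeadingTerm W p hDel hGZK hmod hp5 hcm hadd hG hr hMC
  refine ⟨q, hq, ?_, ?_⟩
  · have hℓ : (0 : ℤ) ≤ padicValNat p ℓ := by exact_mod_cast Nat.zero_le _
    linarith
  · have hℓ : (padicValNat p ℓ : ℤ) ≤ 2 := by exact_mod_cast padicValNat_le_two_of_dvd_sq p hℓp
    linarith

/-- **MC EQUALITY ⟹ `BSD(E,p)` OFF the anomalous rows** of the (G)-cell (rank `0`, `p ≥ 5`, non-CM;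
no image / Tamagawa / Manin / `#Ш_an` hypothesis; every defect `e ∈ {2,3,4,6}`): with `ℓ = 1` the
valuation identity is Miller's last clause, and Gross–Zagier–Kolyvagin supplies the rest.
[cite: Delbourgo2002, Theorem (B) (p. 40)] [cite: Miller2011LMS, Def. 1.1] -/
theorem bsdp_rankZero_of_typeGOrd_of_cycChar_of_nonAnomalous (hDel : Delbourgo2002.mainTheorem)
    (hGZK : rank_eq_analyticRank_of_analyticRank_le_one) (hmod : hasEntireLFunction_rat)
    (hp5 : 5 ≤ p) (hcm : ¬ W.HasCM) (hadd : Addv W p) (hG : TypeGOrd W p)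
    (hr : W.analyticRank = 0) (hMC : CycCharLeadingTermAt W p)
    (hna : Delbourgo2002.ReductionNonAnomalous W p) : BSDp W p := by
  obtain ⟨q, hq, -, ℓ, -, hℓ1, hval⟩ :=
    exists_padicVal_shaAn_of_cycCharLeadingTerm W p hDel hGZK hmod hp5 hcm hadd hG hr hMC
  rw [hℓ1 hna, padicValNat_one_right, Nat.cast_zero, add_zero] at hval
  exact bsdp_of_missingPPartAt W p hGZK (by rw [hr]; exact zero_le_one) ⟨q, hq, hval⟩

variable {W p}

/-! ### §3 Class forms: X4♯(G-ord) and X3♯(G-ord), rank `0`, `p ≥ 5` -/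

/-- **X4♯(G-ord), ANY defect, `p ≥ 5`, `r_an = 0`, `E` non-CM, non-anomalous over the (G)-field:
the LOWER half ⇐ the LOWER divisibility of Delbourgo's MC (G) at `T = 0`.**
X4♯(G-ord) stays CONSTRUCTION-SHAPED. [cite: Delbourgo2002, Theorem (B) (p. 40)] -/
theorem ClassX4Gord.missingLowerBoundAt_rankZero_of_cycLower_of_nonAnomalous
    (hDel : Delbourgo2002.mainTheorem)
    (hGZK : rank_eq_analyticRank_of_analyticRank_le_one) (hmod : hasEntireLFunction_rat)
    (hX : ClassX4Gord W p) (hcm : ¬ W.HasCM) (hp5 : 5 ≤ p) (hr : W.analyticRank = 0)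
    (hLow : CycLowerLeadingTermAt W p) (hna : Delbourgo2002.ReductionNonAnomalous W p) :
    MissingLowerBoundAt W p :=
  missingLowerBoundAt_rankZero_of_typeGOrd_of_cycLower_of_nonAnomalous W p hDel hGZK hmod hp5 hcm
    hX.addv.2 hX.typeGOrd hr hLow hna

/-- **X4♯(G-ord), ANY defect, `p ≥ 5`, `r_an = 0`, `E` non-CM, non-anomalous: `BSD(E,p)` ⇐ BOTH typed
directions at `T = 0` — gen 13's `CycLeadingTermAt` (upper, via Delbourgo 1998 Prop. 4) and
`CycLowerLeadingTermAt` (lower, via Delbourgo 2002).** [cite: Delbourgo2002, Theorem (B) (p. 40)]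
[cite: Delbourgo1998, Prop. 4 (p. 144)] -/
theorem ClassX4Gord.bsdp_rankZero_of_cycLeadingTerm_of_cycLower_of_nonAnomalous
    (hDel98 : Delbourgo1998.prop4_rankZero_pow_dvd_constantCoeff) (hDel : Delbourgo2002.mainTheorem)
    (hGZK : rank_eq_analyticRank_of_analyticRank_le_one) (hmod : hasEntireLFunction_rat)
    (hX : ClassX4Gord W p) (hcm : ¬ W.HasCM) (hp5 : 5 ≤ p) (hr : W.analyticRank = 0)
    (hLT : CycLeadingTermAt W p) (hLow : CycLowerLeadingTermAt W p)
    (hna : Delbourgo2002.ReductionNonAnomalous W p) : BSDp W p :=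
  ClassX4Gord.bsdp_rankZero_of_cycLeadingTerm_of_lower hDel98 hGZK hmod hX hp5 hr hLT
    (ClassX4Gord.missingLowerBoundAt_rankZero_of_cycLower_of_nonAnomalous hDel hGZK hmod hX hcm hp5 hr
      hLow hna)

/-- **X4♯(G-ord), ANY defect, `p ≥ 5`, `r_an = 0`, `E` non-CM: MC EQUALITY at `T = 0` ⟹
`ord_p #Ш ≤ ord_p #Ш_an ≤ ord_p #Ш + 2`, and `BSD(E,p)` off the anomalous rows.** NO image, Tamagawa,
Manin or `#Ш_an` hypothesis. [cite: Delbourgo2002, Theorem (B) (p. 40)] -/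
theorem ClassX4Gord.bsdp_rankZero_of_cycChar_of_nonAnomalous (hDel : Delbourgo2002.mainTheorem)
    (hGZK : rank_eq_analyticRank_of_analyticRank_le_one) (hmod : hasEntireLFunction_rat)
    (hX : ClassX4Gord W p) (hcm : ¬ W.HasCM) (hp5 : 5 ≤ p) (hr : W.analyticRank = 0)
    (hMC : CycCharLeadingTermAt W p) (hna : Delbourgo2002.ReductionNonAnomalous W p) : BSDp W p :=
  bsdp_rankZero_of_typeGOrd_of_cycChar_of_nonAnomalous W p hDel hGZK hmod hp5 hcm hX.addv.2 hX.typeGOrd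
    hr hMC hna

/-- **X4♯(G-ord) ∩ `I₀*` ∩ {`ρ̄_{E,p}` onto}, `p ≥ 5`, `r_an = 0`, `E` non-CM, non-anomalous:
`BSD(E,p)` ⇐ `CycLowerLeadingTermAt W p` ALONE** — the UPPER half is DISCHARGED (gen 12/13: Kato's
component reading A124 `hKa` + the kernel transport + Birch + Pal 2012 Thm. 3.2 `hPal` give `CycLeadingTermAt W p` through
`ClassX4Gord.cycLeadingTermAt_of_katoComponent`), so the residual map's `X_D1` — the LOWER divisibility
of Delbourgo's MC (G) at `T = 0` — is literally the one remaining input on these rows.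
[cite: Delbourgo2002, Theorem (B) (p. 40)] [cite: Kato2004Asterisque, Thm. 17.4 (3)]
[cite: Delbourgo1998, Prop. 4 (p. 144)] -/
theorem ClassX4Gord.bsdp_rankZero_of_cycLower_of_katoComponent
    (hKa : Kato2004.charIdeal_dvd_padicLFunctionBranch_component_of_surjective)
    (hPal : Pal2012.thm32_sqrt_mul_realPeriodRat_twist_eq_of_prime_one_mod_four)
    (hDel98 : Delbourgo1998.prop4_rankZero_pow_dvd_constantCoeff) (hDel : Delbourgo2002.mainTheorem)
    (hGZK : rank_eq_analyticRank_of_analyticRank_le_one) (hmod : hasEntireLFunction_rat)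
    (hmodD : nonempty_modularParametrizationData)
    (hX : ClassX4Gord W p) (hcm : ¬ W.HasCM) (hp5 : 5 ≤ p)
    (he : semistabilityIndex W p = 2) (hsurj : Surj W p) (hr : W.analyticRank = 0)
    (hLow : CycLowerLeadingTermAt W p) (hna : Delbourgo2002.ReductionNonAnomalous W p) : BSDp W p :=
  ClassX4Gord.bsdp_rankZero_of_cycLeadingTerm_of_cycLower_of_nonAnomalous hDel98 hDel hGZK hmod hX hcm
    hp5 hr (ClassX4Gord.cycLeadingTermAt_of_katoComponent W p hKa hPal hmod hmodD hX hp5 he hsurj) hLow hna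

/-- **X3♯(G-ord), ANY defect, `p ≥ 5`, `r_an = 0`, `E` non-CM, non-anomalous: the LOWER half ⇐ the
LOWER divisibility at `T = 0`.** X3♯(G-ord) stays CONSTRUCTION-SHAPED. [cite: Delbourgo2002, Theorem (B) (p. 40)] -/
theorem ClassX3Gord.missingLowerBoundAt_rankZero_of_cycLower_of_nonAnomalous
    (hDel : Delbourgo2002.mainTheorem)
    (hGZK : rank_eq_analyticRank_of_analyticRank_le_one) (hmod : hasEntireLFunction_rat)
    (hX : ClassX3Gord W p) (hcm : ¬ W.HasCM) (hp5 : 5 ≤ p) (hr : W.analyticRank = 0)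
    (hLow : CycLowerLeadingTermAt W p) (hna : Delbourgo2002.ReductionNonAnomalous W p) :
    MissingLowerBoundAt W p :=
  missingLowerBoundAt_rankZero_of_typeGOrd_of_cycLower_of_nonAnomalous W p hDel hGZK hmod hp5 hcm
    hX.addv hX.typeGOrd hr hLow hna

/-- **X3♯(G-ord), ANY defect, `p ≥ 5`, `r_an = 0`, `E` non-CM: MC EQUALITY at `T = 0` ⟹ `BSD(E,p)`
off the anomalous rows** (no image / Tamagawa / Manin / `#Ш_an` hypothesis).
[cite: Delbourgo2002, Theorem (B) (p. 40)] -/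
theorem ClassX3Gord.bsdp_rankZero_of_cycChar_of_nonAnomalous (hDel : Delbourgo2002.mainTheorem)
    (hGZK : rank_eq_analyticRank_of_analyticRank_le_one) (hmod : hasEntireLFunction_rat)
    (hX : ClassX3Gord W p) (hcm : ¬ W.HasCM) (hp5 : 5 ≤ p) (hr : W.analyticRank = 0)
    (hMC : CycCharLeadingTermAt W p) (hna : Delbourgo2002.ReductionNonAnomalous W p) : BSDp W p :=
  bsdp_rankZero_of_typeGOrd_of_cycChar_of_nonAnomalous W p hDel hGZK hmod hp5 hcm hX.addv hX.typeGOrd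
    hr hMC hna

/-- **X3♯(G-ord) ∩ `I₀*`, odd `p ≥ 5`, `r_an = 0`, `E` non-CM, non-anomalous: `BSD(E,p)` ⇐
`CycLowerLeadingTermAt W p` ALONE** — the upper half is discharged by the Wuthrich component reading
A125 (`ClassX3Gord.cycLeadingTermAt_of_wuthrichComponent`, gen 13) + Delbourgo 1998 Prop. 4.
[cite: Delbourgo2002, Theorem (B) (p. 40)] [cite: Wuthrich2014, Thm. 16] [cite: Delbourgo1998, Prop. 4 (p. 144)] -/
theorem ClassX3Gord.bsdp_rankZero_of_cycLower_of_wuthrichComponent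
    (hWu : Wuthrich2014.charIdeal_dvd_padicLFunctionBranch_component)
    (hPal : Pal2012.thm32_sqrt_mul_realPeriodRat_twist_eq_of_prime_one_mod_four)
    (hDel98 : Delbourgo1998.prop4_rankZero_pow_dvd_constantCoeff) (hDel : Delbourgo2002.mainTheorem)
    (hGZK : rank_eq_analyticRank_of_analyticRank_le_one) (hmod : hasEntireLFunction_rat)
    (hmodD : nonempty_modularParametrizationData)
    (hX : ClassX3Gord W p) (hcm : ¬ W.HasCM) (hp5 : 5 ≤ p)
    (he : semistabilityIndex W p = 2) (hr : W.analyticRank = 0)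
    (hLow : CycLowerLeadingTermAt W p) (hna : Delbourgo2002.ReductionNonAnomalous W p) : BSDp W p :=
  bsdp_of_missingPPartAt W p hGZK (by rw [hr]; exact zero_le_one)
    (missingPPartAt_of_lower_of_upper W p
      (ClassX3Gord.missingLowerBoundAt_rankZero_of_cycLower_of_nonAnomalous hDel hGZK hmod hX hcm hp5
        hr hLow hna)
      (ClassX3Gord.missingUpperBoundAt_rankZero_of_cycLeadingTerm hDel98 hGZK hmod hX hp5 hr
        (ClassX3Gord.cycLeadingTermAt_of_wuthrichComponent W p hWu hPal hmod hmodD (by omega) hX he)))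

end Summit.BirchSwinnertonDyer.Rank1Residual.Additive

end
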